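import Summits.RiemannHypothesis.RiemannHypothesis.Theses.SpectralTrace
import HarnessLib

/-!
# Crux `SpectralThesis` (stmt-RiemannHypothesis-0187), line `Sketch` — stub `stub_sawtoothSmoothing`

The Lipschitz estimate for the smoothed sawtooth of a phase. For `q ∈ C¹` with
`|q|, |q'| ≤ Q/(1+t²)`, `∫|q| ≤ Q₀`, `∫|q'| ≤ Q₁`, and two `C²` phases `Φ₁, Φ₂` with `Φᵢ' ≥ c > 0`,
`|Φᵢ''| ≤ L`, `sup|Φ₁−Φ₂| ≤ δ₀`, `sup|Φ₁'−Φ₂'| ≤ δ₁`, `sup|Φ₁''−Φ₂''| ≤ δ₂`: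
`|∫ q(u−s) fract(Φ₁ s) ds − ∫ q(u−s) fract(Φ₂ s) ds|
   ≤ δ₀/2·(Q₁/c + Q₀L/c²) + (Q₁δ₁/c² + Q₀δ₂/c² + 2Q₀Lδ₁/c³)/8`.

Proof: one integration by parts against `ψ₂ = (fract² − fract)/2`, which is continuous,
`1/2`-Lipschitz, bounded by `1/8` in absolute value and vanishes on `ℤ`; its derivative off `ℤ` is
`ψ₁ = fract − 1/2`. With `ρ(s) = q(u−s)/Φ'(s)`,
`∫ q(u−s) fract(Φ s) ds = ∫ [q(u−s)/2 + (q'(u−s)/Φ' + q(u−s)Φ''/Φ'²) ψ₂(Φ s)] ds`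
(FTC with the countable exceptional set `Φ⁻¹(ℤ)` on `[-R, R]`, then `R → ∞`), and the difference of
the right-hand sides for two phases is estimated pointwise and integrated.
-/

noncomputable section

set_option linter.dupNamespace false

open Complex Set MeasureTheory Filter
open scoped Real Topology

namespace Summit.RiemannHypothesis.RiemannHypothesis.Theorems.SpectralThesis.Sketch

namespace SawtoothSmoothing

/-! ### The periodic primitive `ψ₂ = (fract² − fract)/2` of the sawtooth -/

/-- On the cell `[n, n+1]` the function `ψ₂ = (fract² − fract)/2` is the parabola
`((v-n)² − (v-n))/2` (including the right end point, where both vanish). [folklore] -/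
theorem psi2_eq_of_mem_Icc (n : ℤ) (v : ℝ) (hv : v ∈ Icc (n : ℝ) (n + 1)) :
    (Int.fract v ^ 2 - Int.fract v) / 2 = ((v - n) ^ 2 - (v - n)) / 2 := by
  rcases hv.2.eq_or_lt with h | h
  · have : Int.fract v = 0 := by
      rw [h, show (n : ℝ) + 1 = ((n + 1 : ℤ) : ℝ) by push_cast; ring, Int.fract_intCast]
    rw [this, h]; ring
  · have hfl : ⌊v⌋ = n := Int.floor_eq_iff.2 ⟨hv.1, h⟩
    rw [← Int.self_sub_floor, hfl]

/-- `|ψ₂| ≤ 1/8`. [folklore] -/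
theorem abs_psi2_le (v : ℝ) : |(Int.fract v ^ 2 - Int.fract v) / 2| ≤ 1 / 8 := by
  have h0 := Int.fract_nonneg v
  have h1 := Int.fract_lt_one v
  rw [abs_le]
  constructor <;> nlinarith [sq_nonneg (Int.fract v - 1 / 2)]

/-- `ψ₂` is continuous on `ℝ`. [folklore] -/
theorem continuous_psi2 : Continuous fun v : ℝ => (Int.fract v ^ 2 - Int.fract v) / 2 := by
  have h : ContinuousOn (fun x : ℝ => (x ^ 2 - x) / 2) (Icc 0 1) := by fun_prop
  exact h.comp_fract'' (by norm_num)

/-- Off the integers, `ψ₂` has derivative `ψ₁ = fract − 1/2`. [folklore] -/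
theorem hasDerivAt_psi2 (v : ℝ) (hv : ∀ n : ℤ, (n : ℝ) ≠ v) :
    HasDerivAt (fun v : ℝ => (Int.fract v ^ 2 - Int.fract v) / 2) (Int.fract v - 1 / 2) v := by
  set n := ⌊v⌋ with hn
  have hlo : (n : ℝ) < v := lt_of_le_of_ne (Int.floor_le v) (hv n)
  have hhi : v < n + 1 := Int.lt_floor_add_one v
  have hpoly : HasDerivAt (fun w : ℝ => ((w - n) ^ 2 - (w - n)) / 2) (Int.fract v - 1 / 2) v := by
    have h1 : HasDerivAt (fun w : ℝ => w - n) 1 v := (hasDerivAt_id v).sub_const (n : ℝ)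
    refine (((h1.fun_pow 2).fun_sub h1).div_const 2).congr_deriv ?_
    rw [← Int.self_sub_floor, ← hn]
    push_cast
    ring
  refine hpoly.congr_of_eventuallyEq ?_
  filter_upwards [Ioo_mem_nhds hlo hhi] with w hw
  exact psi2_eq_of_mem_Icc n w ⟨hw.1.le, hw.2.le⟩

/-- `ψ₂` is `1/2`-Lipschitz. [folklore] -/
theorem abs_psi2_sub_psi2_le (a b : ℝ) :
    |(Int.fract a ^ 2 - Int.fract a) / 2 - (Int.fract b ^ 2 - Int.fract b) / 2| ≤ |a - b| / 2 := by
  wlog hab : b ≤ a generalizing a b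
  · rw [abs_sub_comm, abs_sub_comm a b]; exact this b a (le_of_not_ge hab)
  have hftc : ∫ t in b..a, (Int.fract t - 1 / 2) =
      (Int.fract a ^ 2 - Int.fract a) / 2 - (Int.fract b ^ 2 - Int.fract b) / 2 := by
    refine integral_eq_of_hasDerivAt_off_countable_of_le
      (fun v : ℝ => (Int.fract v ^ 2 - Int.fract v) / 2) _ hab
      (Set.countable_range (Int.cast : ℤ → ℝ)) continuous_psi2.continuousOn
      (fun x hx => hasDerivAt_psi2 x fun n hn => hx.2 ⟨n, hn⟩) ?_
    refine (intervalIntegrable_const (c := (1 : ℝ))).mono_fun'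
      (measurable_fract.sub_const _).aestronglyMeasurable (ae_of_all _ fun t => ?_)
    show ‖Int.fract t - 1 / 2‖ ≤ 1
    rw [Real.norm_eq_abs, abs_le]
    constructor <;> linarith [Int.fract_nonneg t, Int.fract_lt_one t]
  have hbd : ‖∫ t in b..a, (Int.fract t - 1 / 2)‖ ≤ 1 / 2 * |a - b| := by
    refine intervalIntegral.norm_integral_le_of_norm_le_const fun t _ => ?_
    rw [Real.norm_eq_abs, abs_le]
    constructor <;> linarith [Int.fract_nonneg t, Int.fract_lt_one t]
  rw [hftc, Real.norm_eq_abs] at hbd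
  linarith

/-! ### Decay, integrability and the whole-line integration by parts -/

/-- A function dominated by `Q/(1+t²)` tends to `0` at `+∞` and at `−∞`. [folklore] -/
theorem tendsto_zero_of_abs_le {g : ℝ → ℝ} {Q : ℝ} (h : ∀ t, |g t| ≤ Q / (1 + t ^ 2)) :
    Tendsto g atTop (𝓝 0) ∧ Tendsto g atBot (𝓝 0) := by
  have h2 : Tendsto (fun t : ℝ => Q / (1 + t ^ 2)) atTop (𝓝 0) :=
    tendsto_const_nhds.div_atTop
      (tendsto_atTop_add_const_left _ _ (tendsto_pow_atTop two_ne_zero))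
  have h3 : Tendsto (fun t : ℝ => Q / (1 + t ^ 2)) atBot (𝓝 0) := by
    refine (h2.comp tendsto_neg_atBot_atTop).congr fun t => ?_
    simp only [Function.comp_apply, neg_sq]
  exact ⟨squeeze_zero_norm (fun t => (Real.norm_eq_abs _).le.trans (h t)) h2,
    squeeze_zero_norm (fun t => (Real.norm_eq_abs _).le.trans (h t)) h3⟩

/-- A continuous function dominated by `Q/(1+t²)` is integrable on `ℝ`. [folklore] -/
theorem integrable_of_abs_le {g : ℝ → ℝ} {Q : ℝ} (hg : Continuous g)
    (h : ∀ t, |g t| ≤ Q / (1 + t ^ 2)) : Integrable g :=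
  Integrable.mono' (integrable_inv_one_add_sq.const_mul Q) hg.aestronglyMeasurable
    (ae_of_all _ fun t => by rw [Real.norm_eq_abs, ← div_eq_mul_inv]; exact h t)

/-- **`∫ G' = 0` on the whole line.** If `G : ℝ → ℝ` is continuous, differentiable off a countable
set with an integrable derivative `G'`, and `G → 0` at `±∞`, then `∫ G' = 0` (FTC with a
countable exceptional set on `[-R, R]`, then `R → ∞`). [folklore] -/
theorem integral_deriv_eq_zero {G G' : ℝ → ℝ} {E : Set ℝ} (hE : E.Countable) (hG : Continuous G)
    (hd : ∀ s, s ∉ E → HasDerivAt G (G' s) s) (hG' : Integrable G')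
    (htop : Tendsto G atTop (𝓝 0)) (hbot : Tendsto G atBot (𝓝 0)) : ∫ s, G' s = 0 := by
  have h1 : ∀ R : ℝ, 0 ≤ R → ∫ s in (-R)..R, G' s = G R - G (-R) := fun R hR =>
    integral_eq_of_hasDerivAt_off_countable_of_le G G' (by linarith) hE hG.continuousOn
      (fun x hx => hd x hx.2) hG'.intervalIntegrable
  have h2 : Tendsto (fun R : ℝ => ∫ s in (-R)..R, G' s) atTop (𝓝 (∫ s, G' s)) :=
    intervalIntegral_tendsto_integral hG' tendsto_neg_atTop_atBot tendsto_id
  have h3 : Tendsto (fun R : ℝ => G R - G (-R)) atTop (𝓝 (0 - 0)) :=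
    htop.sub (hbot.comp tendsto_neg_atTop_atBot)
  rw [sub_zero] at h3
  exact tendsto_nhds_unique (h2.congr' ((eventually_ge_atTop 0).mono fun R hR => h1 R hR)) h3

/-- **Integration by parts against `ψ₂ ∘ Φ`.** For `q ∈ C¹` with `q, q' = O(1/(1+t²))` and a
`C²` phase `Φ` with `Φ' ≥ c > 0`, `|Φ''| ≤ L`:
`∫ q(u−s) fract(Φ s) ds = ∫ [q(u−s)/2 + (q'(u−s)/Φ'(s) + q(u−s)Φ''(s)/Φ'(s)²) ψ₂(Φ s)] ds`,
and the right-hand integrand is integrable. [folklore] -/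
theorem integral_mul_fract_eq {q dq : ℝ → ℝ} {Q : ℝ} (hq : ∀ t, HasDerivAt q (dq t) t)
    (hdq : Continuous dq) (hqb : ∀ t, |q t| ≤ Q / (1 + t ^ 2))
    (hdqb : ∀ t, |dq t| ≤ Q / (1 + t ^ 2)) {Φ dΦ ddΦ : ℝ → ℝ} {c L : ℝ} (hc : 0 < c)
    (hΦ : ∀ t, HasDerivAt Φ (dΦ t) t) (hdΦ : ∀ t, HasDerivAt dΦ (ddΦ t) t)
    (hddΦ : Continuous ddΦ) (hcΦ : ∀ t, c ≤ dΦ t) (hLΦ : ∀ t, |ddΦ t| ≤ L) (u : ℝ) :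
    Integrable (fun s => q (u - s) / 2 + (dq (u - s) / dΦ s + q (u - s) * ddΦ s / dΦ s ^ 2) *
        ((Int.fract (Φ s) ^ 2 - Int.fract (Φ s)) / 2)) ∧
    ∫ s, q (u - s) * Int.fract (Φ s) =
      ∫ s, (q (u - s) / 2 + (dq (u - s) / dΦ s + q (u - s) * ddΦ s / dΦ s ^ 2) *
        ((Int.fract (Φ s) ^ 2 - Int.fract (Φ s)) / 2)) := by
  -- continuity facts
  have hq_cont : Continuous q := continuous_iff_continuousAt.2 fun t => (hq t).continuousAt
  have hΦ_cont : Continuous Φ := continuous_iff_continuousAt.2 fun t => (hΦ t).continuousAt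
  have hdΦ_cont : Continuous dΦ := continuous_iff_continuousAt.2 fun t => (hdΦ t).continuousAt
  have hdΦ_pos : ∀ t, 0 < dΦ t := fun t => hc.trans_le (hcΦ t)
  have hdΦ_ne : ∀ t, dΦ t ≠ 0 := fun t => (hdΦ_pos t).ne'
  have hqu_cont : Continuous fun s => q (u - s) := hq_cont.comp (continuous_const.sub continuous_id)
  have hdqu_cont : Continuous fun s => dq (u - s) := hdq.comp (continuous_const.sub continuous_id)
  have hψΦ_cont : Continuous fun s => (Int.fract (Φ s) ^ 2 - Int.fract (Φ s)) / 2 :=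
    continuous_psi2.comp hΦ_cont
  have hσ_cont : Continuous fun s => dq (u - s) / dΦ s + q (u - s) * ddΦ s / dΦ s ^ 2 := by
    refine (hdqu_cont.div₀ hdΦ_cont hdΦ_ne).add ((hqu_cont.mul hddΦ).div₀ (hdΦ_cont.pow 2) ?_)
    exact fun s => pow_ne_zero 2 (hdΦ_ne s)
  -- integrability facts
  have hq_int : Integrable q := integrable_of_abs_le hq_cont hqb
  have hdq_int : Integrable dq := integrable_of_abs_le hdq hdqb
  have hqu_int : Integrable fun s => q (u - s) := hq_int.comp_sub_left u
  have hdqu_int : Integrable fun s => dq (u - s) := hdq_int.comp_sub_left u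
  have hF₁ : Integrable fun s => q (u - s) * Int.fract (Φ s) := by
    refine hqu_int.mul_bdd (c := 1)
      (measurable_fract.comp hΦ_cont.measurable).aestronglyMeasurable (ae_of_all _ fun s => ?_)
    rw [Real.norm_eq_abs, abs_of_nonneg (Int.fract_nonneg _)]
    exact (Int.fract_lt_one _).le
  have hσ_int : Integrable fun s => (dq (u - s) / dΦ s + q (u - s) * ddΦ s / dΦ s ^ 2) *
      ((Int.fract (Φ s) ^ 2 - Int.fract (Φ s)) / 2) := by
    have hσ : Integrable fun s => dq (u - s) / dΦ s + q (u - s) * ddΦ s / dΦ s ^ 2 := by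
      refine Integrable.mono' ((hdqu_int.norm.div_const c).add (hqu_int.norm.mul_const (L / c ^ 2)))
        hσ_cont.aestronglyMeasurable (ae_of_all _ fun s => ?_)
      refine (norm_add_le _ _).trans (add_le_add ?_ ?_)
      · rw [norm_div, Real.norm_of_nonneg (hdΦ_pos s).le]
        exact div_le_div_of_nonneg_left (norm_nonneg _) hc (hcΦ s)
      · rw [mul_div_assoc, norm_mul, norm_div, norm_pow, Real.norm_of_nonneg (hdΦ_pos s).le,
          Real.norm_eq_abs (ddΦ s)]
        refine mul_le_mul_of_nonneg_left ?_ (norm_nonneg _)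
        have h2 : c ^ 2 ≤ dΦ s ^ 2 := pow_le_pow_left₀ hc.le (hcΦ s) 2
        calc |ddΦ s| / dΦ s ^ 2 ≤ L / dΦ s ^ 2 :=
              div_le_div_of_nonneg_right (hLΦ s) (pow_pos (hdΦ_pos s) 2).le
          _ ≤ L / c ^ 2 :=
              div_le_div_of_nonneg_left ((abs_nonneg _).trans (hLΦ s)) (pow_pos hc 2) h2
    refine hσ.mul_bdd (c := 1 / 8) hψΦ_cont.aestronglyMeasurable (ae_of_all _ fun s => ?_)
    rw [Real.norm_eq_abs]
    exact abs_psi2_le _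
  have hF₂ : Integrable fun s => q (u - s) / 2 + (dq (u - s) / dΦ s + q (u - s) * ddΦ s /
      dΦ s ^ 2) * ((Int.fract (Φ s) ^ 2 - Int.fract (Φ s)) / 2) := (hqu_int.div_const 2).add hσ_int
  refine ⟨hF₂, ?_⟩
  -- the exceptional set `E = Φ⁻¹(ℤ)` is countable
  have hE : (Φ ⁻¹' Set.range (Int.cast : ℤ → ℝ)).Countable := by
    refine (Set.countable_range _).preimage (StrictMono.injective (strictMono_of_deriv_pos ?_))
    intro x
    rw [(hΦ x).deriv]
    exact hdΦ_pos x
  -- the primitive `G = (q(u−·)/Φ') · ψ₂ ∘ Φ` and its derivative off `E`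
  have hderiv : ∀ s, s ∉ Φ ⁻¹' Set.range (Int.cast : ℤ → ℝ) →
      HasDerivAt (fun s => q (u - s) / dΦ s * ((Int.fract (Φ s) ^ 2 - Int.fract (Φ s)) / 2))
        (q (u - s) * Int.fract (Φ s) - (q (u - s) / 2 +
          (dq (u - s) / dΦ s + q (u - s) * ddΦ s / dΦ s ^ 2) *
            ((Int.fract (Φ s) ^ 2 - Int.fract (Φ s)) / 2))) s := by
    intro s hs
    have h1 : HasDerivAt (fun s => q (u - s)) (dq (u - s) * -1) s :=
      (hq (u - s)).comp s ((hasDerivAt_id' s).const_sub u)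
    have h2 : HasDerivAt (fun v : ℝ => (Int.fract v ^ 2 - Int.fract v) / 2)
        (Int.fract (Φ s) - 1 / 2) (Φ s) :=
      hasDerivAt_psi2 (Φ s) fun n hn => hs ⟨n, hn⟩
    have h3 : HasDerivAt (fun s => (Int.fract (Φ s) ^ 2 - Int.fract (Φ s)) / 2)
        ((Int.fract (Φ s) - 1 / 2) * dΦ s) s := h2.comp s (hΦ s)
    refine ((h1.fun_div (hdΦ s) (hdΦ_ne s)).fun_mul h3).congr_deriv ?_
    have hne := hdΦ_ne s
    field_simp
    ring
  have hG_cont : Continuous fun s =>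
      q (u - s) / dΦ s * ((Int.fract (Φ s) ^ 2 - Int.fract (Φ s)) / 2) :=
    (hqu_cont.div₀ hdΦ_cont hdΦ_ne).mul hψΦ_cont
  -- decay of `G` at `±∞`
  have hG_bd : ∀ s, ‖q (u - s) / dΦ s * ((Int.fract (Φ s) ^ 2 - Int.fract (Φ s)) / 2)‖ ≤
      c⁻¹ * |q (u - s)| := by
    intro s
    rw [Real.norm_eq_abs, abs_mul, abs_div, abs_of_pos (hdΦ_pos s)]
    calc |q (u - s)| / dΦ s * |(Int.fract (Φ s) ^ 2 - Int.fract (Φ s)) / 2|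
        ≤ |q (u - s)| / c * 1 :=
          mul_le_mul (div_le_div_of_nonneg_left (abs_nonneg _) hc (hcΦ s))
            ((abs_psi2_le _).trans (by norm_num)) (abs_nonneg _) (by positivity)
      _ = c⁻¹ * |q (u - s)| := by ring
  obtain ⟨hq_top, hq_bot⟩ := tendsto_zero_of_abs_le hqb
  have hqu_top : Tendsto (fun s => q (u - s)) atTop (𝓝 0) := by
    refine (hq_bot.comp (tendsto_atBot_add_const_left atTop u tendsto_neg_atTop_atBot)).congr ?_
    intro s
    simp [sub_eq_add_neg]
  have hqu_bot : Tendsto (fun s => q (u - s)) atBot (𝓝 0) := by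
    refine (hq_top.comp (tendsto_atTop_add_const_left atBot u tendsto_neg_atBot_atTop)).congr ?_
    intro s
    simp [sub_eq_add_neg]
  have hG_top : Tendsto (fun s =>
      q (u - s) / dΦ s * ((Int.fract (Φ s) ^ 2 - Int.fract (Φ s)) / 2)) atTop (𝓝 0) :=
    squeeze_zero_norm hG_bd (by simpa using (hqu_top.abs).const_mul c⁻¹)
  have hG_bot : Tendsto (fun s =>
      q (u - s) / dΦ s * ((Int.fract (Φ s) ^ 2 - Int.fract (Φ s)) / 2)) atBot (𝓝 0) :=
    squeeze_zero_norm hG_bd (by simpa using (hqu_bot.abs).const_mul c⁻¹)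
  have key := integral_deriv_eq_zero hE hG_cont hderiv (hF₁.sub hF₂) hG_top hG_bot
  rw [integral_sub hF₁ hF₂] at key
  exact sub_eq_zero.mp key

/-! ### The pointwise estimate -/

/-- The pointwise estimate behind the Lipschitz bound: for `a, b ≥ c > 0`, `|A|, |B| ≤ L`,
`|a − b| ≤ δ₁`, `|A − B| ≤ δ₂`, `|p₁ − p₂| ≤ δ`, `|p₂| ≤ 1/8`:
`|(y/a + xA/a²)p₁ − (y/b + xB/b²)p₂| ≤ |y|(δ/c + δ₁/(8c²)) + |x|(δL/c² + δ₂/(8c²) + 2Lδ₁/(8c³))`.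
[folklore] -/
theorem pointwise_bound {x y a b A B p₁ p₂ c L δ δ₁ δ₂ : ℝ} (hc : 0 < c)
    (ha : c ≤ a) (hb : c ≤ b) (hA : |A| ≤ L) (hB : |B| ≤ L) (hab : |a - b| ≤ δ₁)
    (hAB : |A - B| ≤ δ₂) (hp : |p₁ - p₂| ≤ δ) (hp₂ : |p₂| ≤ 1 / 8) :
    |(y / a + x * A / a ^ 2) * p₁ - (y / b + x * B / b ^ 2) * p₂| ≤
      |y| * (δ / c + δ₁ / (8 * c ^ 2)) +
        |x| * (δ * L / c ^ 2 + δ₂ / (8 * c ^ 2) + 2 * L * δ₁ / (8 * c ^ 3)) := by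
  have ha0 : 0 < a := hc.trans_le ha
  have hb0 : 0 < b := hc.trans_le hb
  have hL : 0 ≤ L := (abs_nonneg A).trans hA
  have hδ₁ : 0 ≤ δ₁ := (abs_nonneg _).trans hab
  have hδ₂ : 0 ≤ δ₂ := (abs_nonneg _).trans hAB
  set k := c⁻¹ with hk
  have hk0 : 0 < k := inv_pos.2 hc
  have hia : a⁻¹ ≤ k := inv_anti₀ hc ha
  have hib : b⁻¹ ≤ k := inv_anti₀ hc hb
  have hia0 : 0 < a⁻¹ := inv_pos.2 ha0
  have hib0 : 0 < b⁻¹ := inv_pos.2 hb0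
  have hia2 : a⁻¹ ^ 2 ≤ k ^ 2 := pow_le_pow_left₀ hia0.le hia 2
  have hiab : |a⁻¹ - b⁻¹| ≤ k * δ₁ * k := by
    rw [inv_sub_inv' ha0.ne' hb0.ne', abs_mul, abs_mul, abs_of_pos hia0, abs_of_pos hib0,
      abs_sub_comm]
    exact mul_le_mul (mul_le_mul hia hab (abs_nonneg _) hk0.le) hib hib0.le (by positivity)
  have hE : (y / a + x * A / a ^ 2) * p₁ - (y / b + x * B / b ^ 2) * p₂ =
      y * (a⁻¹ * (p₁ - p₂) + (a⁻¹ - b⁻¹) * p₂) +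
        x * (A * a⁻¹ ^ 2 * (p₁ - p₂) +
          ((A - B) * a⁻¹ ^ 2 + B * (a⁻¹ - b⁻¹) * (a⁻¹ + b⁻¹)) * p₂) := by
    ring
  have hP : |a⁻¹ * (p₁ - p₂) + (a⁻¹ - b⁻¹) * p₂| ≤ k * δ + k * δ₁ * k * (1 / 8) := by
    refine (abs_add_le _ _).trans ?_
    rw [abs_mul, abs_mul, abs_of_pos hia0]
    exact add_le_add (mul_le_mul hia hp (abs_nonneg _) hk0.le)
      (mul_le_mul hiab hp₂ (abs_nonneg _) (by positivity))
  have hR : |A * a⁻¹ ^ 2 * (p₁ - p₂) + ((A - B) * a⁻¹ ^ 2 + B * (a⁻¹ - b⁻¹) * (a⁻¹ + b⁻¹)) * p₂|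
      ≤ L * k ^ 2 * δ + (δ₂ * k ^ 2 + L * (k * δ₁ * k) * (k + k)) * (1 / 8) := by
    refine (abs_add_le _ _).trans (add_le_add ?_ ?_)
    · rw [abs_mul, abs_mul, abs_of_pos (pow_pos hia0 2)]
      exact mul_le_mul (mul_le_mul hA hia2 (by positivity) hL) hp (abs_nonneg _) (by positivity)
    · rw [abs_mul]
      refine mul_le_mul ?_ hp₂ (abs_nonneg _) (by positivity)
      refine (abs_add_le _ _).trans ?_
      rw [abs_mul, abs_of_pos (pow_pos hia0 2), abs_mul, abs_mul, abs_of_pos (add_pos hia0 hib0)]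
      exact add_le_add (mul_le_mul hAB hia2 (by positivity) hδ₂)
        (mul_le_mul (mul_le_mul hB hiab (abs_nonneg _) hL) (add_le_add hia hib) (by positivity)
          (by positivity))
  rw [hE]
  refine (abs_add_le _ _).trans ?_
  rw [abs_mul, abs_mul]
  refine (add_le_add (mul_le_mul_of_nonneg_left hP (abs_nonneg _))
    (mul_le_mul_of_nonneg_left hR (abs_nonneg _))).trans_eq ?_
  rw [hk]
  field_simp
  ring

end SawtoothSmoothing

open SawtoothSmoothing

/-- **STUB · `stub_sawtoothSmoothing`** — the Lipschitz estimate for the smoothed sawtooth of a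
phase: for `q ∈ C¹` with `q, q' ∈ L¹ ∩ O(1/(1+t²))` and two `C²` phases with `Φᵢ' ≥ c`,
`|Φᵢ''| ≤ L`,
`|∫ q(u−s)(fract Φ₁(s) − fract Φ₂(s)) ds| ≤ δ₀/2 (Q₁/c + Q₀L/c²) + (Q₁δ₁ + Q₀δ₂ + 2Q₀Lδ₁/c)/(8c²)`
(integrate by parts against `ψ₂ ∘ Φᵢ`, `ψ₂ = (fract² − fract)/2`: `|ψ₂| ≤ 1/8`, `Lip ψ₂ = 1/2`).
[folklore] -/
theorem stub_sawtoothSmoothing :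
    ∀ (q dq : ℝ → ℝ) (Q₀ Q₁ Q : ℝ), (∀ t, HasDerivAt q (dq t) t) → Continuous dq →
      (∀ t, |q t| ≤ Q / (1 + t ^ 2)) → (∀ t, |dq t| ≤ Q / (1 + t ^ 2)) →
      (∫ t, |q t|) ≤ Q₀ → (∫ t, |dq t|) ≤ Q₁ →
      ∀ (Φ₁ dΦ₁ ddΦ₁ Φ₂ dΦ₂ ddΦ₂ : ℝ → ℝ) (c L δ₀ δ₁ δ₂ : ℝ), 0 < c → 0 ≤ L →
        0 ≤ δ₀ → 0 ≤ δ₁ → 0 ≤ δ₂ →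
        (∀ t, HasDerivAt Φ₁ (dΦ₁ t) t) → (∀ t, HasDerivAt dΦ₁ (ddΦ₁ t) t) → Continuous ddΦ₁ →
        (∀ t, HasDerivAt Φ₂ (dΦ₂ t) t) → (∀ t, HasDerivAt dΦ₂ (ddΦ₂ t) t) → Continuous ddΦ₂ →
        (∀ t, c ≤ dΦ₁ t) → (∀ t, c ≤ dΦ₂ t) → (∀ t, |ddΦ₁ t| ≤ L) → (∀ t, |ddΦ₂ t| ≤ L) →
        (∀ t, |Φ₁ t - Φ₂ t| ≤ δ₀) → (∀ t, |dΦ₁ t - dΦ₂ t| ≤ δ₁) →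
        (∀ t, |ddΦ₁ t - ddΦ₂ t| ≤ δ₂) →
        ∀ u : ℝ, |(∫ s, q (u - s) * Int.fract (Φ₁ s)) - (∫ s, q (u - s) * Int.fract (Φ₂ s))| ≤
          δ₀ / 2 * (Q₁ / c + Q₀ * L / c ^ 2) +
            (Q₁ * δ₁ / c ^ 2 + Q₀ * δ₂ / c ^ 2 + 2 * Q₀ * L * δ₁ / c ^ 3) / 8 := by
  intro q dq Q₀ Q₁ Q hq hdq hqb hdqb hQ₀ hQ₁ Φ₁ dΦ₁ ddΦ₁ Φ₂ dΦ₂ ddΦ₂ c L δ₀ δ₁ δ₂ hc hL hδ₀ hδ₁ hδ₂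
    hΦ₁ hdΦ₁ hddΦ₁ hΦ₂ hdΦ₂ hddΦ₂ hc₁ hc₂ hL₁ hL₂ h₀ h₁ h₂ u
  obtain ⟨hint₁, hrep₁⟩ := integral_mul_fract_eq hq hdq hqb hdqb hc hΦ₁ hdΦ₁ hddΦ₁ hc₁ hL₁ u
  obtain ⟨hint₂, hrep₂⟩ := integral_mul_fract_eq hq hdq hqb hdqb hc hΦ₂ hdΦ₂ hddΦ₂ hc₂ hL₂ u
  have hq_cont : Continuous q := continuous_iff_continuousAt.2 fun t => (hq t).continuousAt
  have hq_int : Integrable q := integrable_of_abs_le hq_cont hqb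
  have hdq_int : Integrable dq := integrable_of_abs_le hdq hdqb
  have hqu_int : Integrable fun s => q (u - s) := hq_int.comp_sub_left u
  have hdqu_int : Integrable fun s => dq (u - s) := hdq_int.comp_sub_left u
  -- the two constants of the pointwise bound
  set α : ℝ := δ₀ / 2 / c + δ₁ / (8 * c ^ 2) with hα
  set β : ℝ := δ₀ / 2 * L / c ^ 2 + δ₂ / (8 * c ^ 2) + 2 * L * δ₁ / (8 * c ^ 3) with hβ
  have hα0 : 0 ≤ α := by positivity
  have hβ0 : 0 ≤ β := by positivity
  have hpt : ∀ s, |(q (u - s) / 2 + (dq (u - s) / dΦ₁ s + q (u - s) * ddΦ₁ s / dΦ₁ s ^ 2) *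
      ((Int.fract (Φ₁ s) ^ 2 - Int.fract (Φ₁ s)) / 2)) - (q (u - s) / 2 +
      (dq (u - s) / dΦ₂ s + q (u - s) * ddΦ₂ s / dΦ₂ s ^ 2) *
      ((Int.fract (Φ₂ s) ^ 2 - Int.fract (Φ₂ s)) / 2))| ≤ |dq (u - s)| * α + |q (u - s)| * β := by
    intro s
    rw [add_sub_add_left_eq_sub]
    exact pointwise_bound hc (hc₁ s) (hc₂ s) (hL₁ s) (hL₂ s) (h₁ s) (h₂ s)
      ((abs_psi2_sub_psi2_le _ _).trans (by linarith [h₀ s])) (abs_psi2_le _)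
  have hbd_int : Integrable fun s => |dq (u - s)| * α + |q (u - s)| * β :=
    (hdqu_int.abs.mul_const α).add (hqu_int.abs.mul_const β)
  rw [hrep₁, hrep₂, ← integral_sub hint₁ hint₂]
  calc |∫ s, (q (u - s) / 2 + (dq (u - s) / dΦ₁ s + q (u - s) * ddΦ₁ s / dΦ₁ s ^ 2) *
          ((Int.fract (Φ₁ s) ^ 2 - Int.fract (Φ₁ s)) / 2)) - (q (u - s) / 2 +
          (dq (u - s) / dΦ₂ s + q (u - s) * ddΦ₂ s / dΦ₂ s ^ 2) *
          ((Int.fract (Φ₂ s) ^ 2 - Int.fract (Φ₂ s)) / 2))|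
      ≤ ∫ s, |(q (u - s) / 2 + (dq (u - s) / dΦ₁ s + q (u - s) * ddΦ₁ s / dΦ₁ s ^ 2) *
          ((Int.fract (Φ₁ s) ^ 2 - Int.fract (Φ₁ s)) / 2)) - (q (u - s) / 2 +
          (dq (u - s) / dΦ₂ s + q (u - s) * ddΦ₂ s / dΦ₂ s ^ 2) *
          ((Int.fract (Φ₂ s) ^ 2 - Int.fract (Φ₂ s)) / 2))| := abs_integral_le_integral_abs
    _ ≤ ∫ s, (|dq (u - s)| * α + |q (u - s)| * β) :=
        integral_mono (hint₁.sub hint₂).abs hbd_int hpt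
    _ = (∫ s, |dq s|) * α + (∫ s, |q s|) * β := by
        rw [integral_add (hdqu_int.abs.mul_const α) (hqu_int.abs.mul_const β),
          integral_mul_const, integral_mul_const]
        have e₁ : ∫ s, |dq (u - s)| = ∫ s, |dq s| :=
          integral_sub_left_eq_self (fun t => |dq t|) volume u
        have e₂ : ∫ s, |q (u - s)| = ∫ s, |q s| :=
          integral_sub_left_eq_self (fun t => |q t|) volume u
        rw [e₁, e₂]
    _ ≤ Q₁ * α + Q₀ * β := add_le_add (mul_le_mul_of_nonneg_right hQ₁ hα0)
        (mul_le_mul_of_nonneg_right hQ₀ hβ0)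
    _ = δ₀ / 2 * (Q₁ / c + Q₀ * L / c ^ 2) +
          (Q₁ * δ₁ / c ^ 2 + Q₀ * δ₂ / c ^ 2 + 2 * Q₀ * L * δ₁ / c ^ 3) / 8 := by
        rw [hα, hβ]
        ring

end Summit.RiemannHypothesis.RiemannHypothesis.Theorems.SpectralThesis.Sketch
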